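import Summits.Ventures.PercRepro.LineLadderArith

/-!
# PercRepro — C-025 on `T_p(M(K₄) ⊕ U_{m,m})`: the arithmetic half, I — Pascal steps and the base layer (p9, gen 13)

`proofs/P9-S4-LINELADDER-g13.md` §8: for the block `M(K₄)` (profiles `(0,3)·1 (1,3)·6 (2,3)·19 (3,3)·12 (3,2)·19 (3,1)·6 (3,0)·1`)
and `m ≥ p + q − 3` generic points the two level sets of C-025 at `(p, q)` have the closed forms (`c_a = C(m, a)`)

  `#U = 38·c_{q−3} + 19·c_{q−2} + 6·c_{q−1} + c_q`,
  `#Y = Σ_{q<a<p} c_a + 6·Σ_{q≤a≤p−2} c_a + 19·Σ_{q−1≤a≤p−3} c_a + 38·Σ_{q−2≤a≤p−4} c_a`.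

This file is the first half of the proof of `Φ(p,q)·#U ≤ #Y` (`q ≥ 3`, `p ≥ q + 2`, `m ≥ p + q − 3`; the theorem
`k4_ineq` is in `K4LadderArith`), by the method of `LineLadderArith`:

* Pascal's rule for `m → m + 1` (`uK_succ`, `yK_succ`): the counts at `(p, q, m+1)` are the counts at `(p, q, m)`
  plus those at `(p−1, q−1, m)`;
* the base layer `m = K = p + q − 3` (`k4_base`): the Pascal CUBE `C(K+3, u) = c_u + 3c_{u−1} + 3c_{u−2} + c_{u−3}`
  writes `Φ(p,q)` as a ratio of partial row sums, the symmetry `c_a = c_{K−a}` identifies them, and the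
  cross-multiplied inequality is `c_{q}² · G(s, r) / ((r+1)(r+2)(r+3))²` plus a product of nonnegative differences,
  `G` an explicit polynomial with 27 positive monomials (`field_simp; ring`, then `nlinarith`).

No matroid is mentioned: the bridge to `M(K₄)` (the matroid itself is not in the tree) is future work; nothing
here is about the windows of S4.
-/

namespace PercRepro.LineLadder

open Finset

/-! The counts are written out (no definitions): `#U(q, m) = 38·C(m, q−3) + 19·C(m, q−2) + 6·C(m, q−1) + C(m, q)`,
`#Y(p, q, m) = Σ_{a ∈ [q+1, p)} C(m,a) + 6·Σ_{a ∈ [q, p−1)} C(m,a) + 19·Σ_{a ∈ [q−1, p−2)} C(m,a) + 38·Σ_{a ∈ [q−2, p−3)} C(m,a)`. -/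

/-- Pascal for `#U` at level `q + 4` on `m + 1` points. -/
lemma uK_succ (r m : ℕ) :
    (38 * (m + 1).choose (r + 4 - 3) + 19 * (m + 1).choose (r + 4 - 2) + 6 * (m + 1).choose (r + 4 - 1)
        + (m + 1).choose (r + 4) : ℕ)
      = (38 * m.choose (r + 4 - 3) + 19 * m.choose (r + 4 - 2) + 6 * m.choose (r + 4 - 1) + m.choose (r + 4) : ℕ)
        + (38 * m.choose (r + 3 - 3) + 19 * m.choose (r + 3 - 2) + 6 * m.choose (r + 3 - 1) + m.choose (r + 3) : ℕ) := by
  simp only [show r + 4 - 3 = r + 1 by omega, show r + 4 - 2 = r + 2 by omega, show r + 4 - 1 = r + 3 by omega,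
    show r + 3 - 3 = r by omega, show r + 3 - 2 = r + 1 by omega, show r + 3 - 1 = r + 2 by omega,
    Nat.choose_succ_succ']
  ring

/-- Pascal for `#U` at level `3` on `m + 1` points: the level-`2` count is `19 + 6m + C(m,2)`. -/
lemma uK_three_succ (m : ℕ) :
    (38 * (m + 1).choose 0 + 19 * (m + 1).choose 1 + 6 * (m + 1).choose 2 + (m + 1).choose 3 : ℕ)
      = (38 * m.choose 0 + 19 * m.choose 1 + 6 * m.choose 2 + m.choose 3 : ℕ)
        + (19 * m.choose 0 + 6 * m.choose 1 + m.choose 2 : ℕ) := by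
  simp only [Nat.choose_zero_right, Nat.choose_succ_succ']
  rw [Nat.choose_one_right]
  ring

/-- Pascal for `#Y` (`q ≥ 3`, `p ≥ 4`). -/
lemma yK_succ (r s m : ℕ) :
    (∑ a ∈ Ico (r + 3 + 1) (s + 4), (m + 1).choose a + 6 * ∑ a ∈ Ico (r + 3) (s + 4 - 1), (m + 1).choose a
        + 19 * ∑ a ∈ Ico (r + 3 - 1) (s + 4 - 2), (m + 1).choose a
        + 38 * ∑ a ∈ Ico (r + 3 - 2) (s + 4 - 3), (m + 1).choose a : ℕ)
      = (∑ a ∈ Ico (r + 3 + 1) (s + 4), m.choose a + 6 * ∑ a ∈ Ico (r + 3) (s + 4 - 1), m.choose a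
        + 19 * ∑ a ∈ Ico (r + 3 - 1) (s + 4 - 2), m.choose a + 38 * ∑ a ∈ Ico (r + 3 - 2) (s + 4 - 3), m.choose a : ℕ)
        + (∑ a ∈ Ico (r + 2 + 1) (s + 3), m.choose a + 6 * ∑ a ∈ Ico (r + 2) (s + 3 - 1), m.choose a
        + 19 * ∑ a ∈ Ico (r + 2 - 1) (s + 3 - 2), m.choose a + 38 * ∑ a ∈ Ico (r + 2 - 2) (s + 3 - 3), m.choose a : ℕ) := by
  rw [sum_choose_succ' m (r + 3 + 1) (s + 4) (by omega), sum_choose_succ' m (r + 3) (s + 4 - 1) (by omega),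
    sum_choose_succ' m (r + 3 - 1) (s + 4 - 2) (by omega), sum_choose_succ' m (r + 3 - 2) (s + 4 - 3) (by omega)]
  simp only [show r + 3 + 1 = r + 4 by omega, show r + 3 + 1 - 1 = r + 3 by omega, show s + 4 - 1 = s + 3 by omega,
    show r + 3 - 1 = r + 2 by omega, show s + 4 - 2 = s + 2 by omega, show r + 3 - 2 = r + 1 by omega,
    show s + 4 - 3 = s + 1 by omega, show r + 2 + 1 = r + 3 by omega, show s + 3 - 1 = s + 2 by omega,
    show r + 2 - 1 = r + 1 by omega, show s + 3 - 2 = s + 1 by omega, show r + 2 - 2 = r by omega,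
    show s + 3 - 3 = s by omega, show r + 1 - 1 = r by omega, show s + 2 - 1 = s + 1 by omega,
    show s + 1 - 1 = s by omega]
  ring

/-- The Pascal cube for the numerator of `Φ` at the base layer `K = p + q − 3` (`q = r + 3`, `p = r + s + 5`):
`Σ_{q<u<p} C(K+3, u) = A + 3B + 3C + D`. -/
lemma k4_num_eq (r s : ℕ) :
    ∑ u ∈ Ioo (r + 3) (r + s + 5), (2 * r + s + 5 + 3).choose u
      = ∑ a ∈ Ico (r + 4) (r + s + 5), (2 * r + s + 5).choose a
        + 3 * ∑ a ∈ Ico (r + 3) (r + s + 4), (2 * r + s + 5).choose a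
        + 3 * ∑ a ∈ Ico (r + 2) (r + s + 3), (2 * r + s + 5).choose a
        + ∑ a ∈ Ico (r + 1) (r + s + 2), (2 * r + s + 5).choose a := by
  rw [Ioo_eq_Ico', show 2 * r + s + 5 + 3 = (2 * r + s + 5 + 2) + 1 by omega,
    sum_choose_succ' (2 * r + s + 5 + 2) (r + 3 + 1) (r + s + 5) (by omega),
    show 2 * r + s + 5 + 2 = (2 * r + s + 5 + 1) + 1 by omega,
    sum_choose_succ' (2 * r + s + 5 + 1) (r + 3 + 1) (r + s + 5) (by omega),
    sum_choose_succ' (2 * r + s + 5 + 1) (r + 3 + 1 - 1) (r + s + 5 - 1) (by omega),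
    show 2 * r + s + 5 + 1 = (2 * r + s + 5) + 1 by omega,
    sum_choose_succ' (2 * r + s + 5) (r + 3 + 1) (r + s + 5) (by omega),
    sum_choose_succ' (2 * r + s + 5) (r + 3 + 1 - 1) (r + s + 5 - 1) (by omega),
    sum_choose_succ' (2 * r + s + 5) (r + 3 + 1 - 1 - 1) (r + s + 5 - 1 - 1) (by omega)]
  simp only [show r + 3 + 1 = r + 4 by omega, show r + 4 - 1 = r + 3 by omega, show r + s + 5 - 1 = r + s + 4 by omega,
    show r + 3 - 1 = r + 2 by omega, show r + s + 4 - 1 = r + s + 3 by omega, show r + 2 - 1 = r + 1 by omega,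
    show r + s + 3 - 1 = r + s + 2 by omega]
  ring

/-- The Pascal cube for the denominator of `Φ` at the base layer: `C(K+3, p) = c_{q−3} + 3c_{q−2} + 3c_{q−1} + c_q`. -/
lemma k4_den_eq (r s : ℕ) :
    (2 * r + s + 5 + 3).choose (r + s + 5)
      = (2 * r + s + 5).choose r + 3 * (2 * r + s + 5).choose (r + 1) + 3 * (2 * r + s + 5).choose (r + 2)
        + (2 * r + s + 5).choose (r + 3) := by
  have a1 := Nat.choose_succ_succ' (2 * r + s + 5 + 2) (r + s + 4)
  have a2 := Nat.choose_succ_succ' (2 * r + s + 5 + 1) (r + s + 3)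
  have a3 := Nat.choose_succ_succ' (2 * r + s + 5 + 1) (r + s + 4)
  have a4 := Nat.choose_succ_succ' (2 * r + s + 5) (r + s + 2)
  have a5 := Nat.choose_succ_succ' (2 * r + s + 5) (r + s + 3)
  have a6 := Nat.choose_succ_succ' (2 * r + s + 5) (r + s + 4)
  simp only [show 2 * r + s + 5 + 2 + 1 = 2 * r + s + 5 + 3 by omega, show 2 * r + s + 5 + 1 + 1 = 2 * r + s + 5 + 2 by omega,
    show r + s + 4 + 1 = r + s + 5 by omega, show r + s + 3 + 1 = r + s + 4 by omega,
    show r + s + 2 + 1 = r + s + 3 by omega] at a1 a2 a3 a4 a5 a6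
  have e1 : (2 * r + s + 5).choose (r + s + 2) = (2 * r + s + 5).choose (r + 3) := by
    rw [← Nat.choose_symm (show r + 3 ≤ 2 * r + s + 5 by omega), show 2 * r + s + 5 - (r + 3) = r + s + 2 by omega]
  have e2 : (2 * r + s + 5).choose (r + s + 3) = (2 * r + s + 5).choose (r + 2) := by
    rw [← Nat.choose_symm (show r + 2 ≤ 2 * r + s + 5 by omega), show 2 * r + s + 5 - (r + 2) = r + s + 3 by omega]
  have e3 : (2 * r + s + 5).choose (r + s + 4) = (2 * r + s + 5).choose (r + 1) := by
    rw [← Nat.choose_symm (show r + 1 ≤ 2 * r + s + 5 by omega), show 2 * r + s + 5 - (r + 1) = r + s + 4 by omega]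
  have e4 : (2 * r + s + 5).choose (r + s + 5) = (2 * r + s + 5).choose r := by
    rw [← Nat.choose_symm (show r ≤ 2 * r + s + 5 by omega), show 2 * r + s + 5 - r = r + s + 5 by omega]
  omega

/-- `C(n, k+1)·(k+1) = C(n, k)·(n − k)` in the form used below. -/
lemma choose_ratio (n k : ℕ) : n.choose (k + 1) * (k + 1) = n.choose k * (n - k) :=
  Nat.choose_succ_right_eq n k

set_option maxHeartbeats 1600000 in
/-- **THE K₄ BASE LAYER** (`q = r + 3`, `p = r + s + 5`, `m = K = p + q − 3 = 2r + s + 5`): `Φ(p,q)·#U ≤ #Y`. -/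
lemma k4_base (r s : ℕ) :
    phiK (r + s + 5) (r + 3) *
        ((38 * (2 * r + s + 5).choose (r + 3 - 3) + 19 * (2 * r + s + 5).choose (r + 3 - 2)
          + 6 * (2 * r + s + 5).choose (r + 3 - 1) + (2 * r + s + 5).choose (r + 3) : ℕ) : ℚ)
      ≤ ((∑ a ∈ Ico (r + 3 + 1) (r + s + 5), (2 * r + s + 5).choose a
          + 6 * ∑ a ∈ Ico (r + 3) (r + s + 5 - 1), (2 * r + s + 5).choose a
          + 19 * ∑ a ∈ Ico (r + 3 - 1) (r + s + 5 - 2), (2 * r + s + 5).choose a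
          + 38 * ∑ a ∈ Ico (r + 3 - 2) (r + s + 5 - 3), (2 * r + s + 5).choose a : ℕ) : ℚ) := by
  set K := 2 * r + s + 5 with hK
  set A := ∑ a ∈ Ico (r + 4) (r + s + 5), K.choose a with hA
  set B := ∑ a ∈ Ico (r + 3) (r + s + 4), K.choose a with hB
  set Cc := ∑ a ∈ Ico (r + 2) (r + s + 3), K.choose a with hCc
  set D := ∑ a ∈ Ico (r + 1) (r + s + 2), K.choose a with hD
  set c3 := K.choose r with hc3
  set c2 := K.choose (r + 1) with hc2
  set c1 := K.choose (r + 2) with hc1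
  set c0 := K.choose (r + 3) with hc0
  have hnum : ∑ u ∈ Ioo (r + 3) (r + s + 5), (K + 3).choose u = A + 3 * B + 3 * Cc + D := k4_num_eq r s
  have hden : (K + 3).choose (r + s + 5) = c3 + 3 * c2 + 3 * c1 + c0 := k4_den_eq r s
  have hphi : phiK (r + s + 5) (r + 3) = ((A + 3 * B + 3 * Cc + D : ℕ) : ℚ) / ((c3 + 3 * c2 + 3 * c1 + c0 : ℕ) : ℚ) := by
    unfold phiK
    rw [show r + s + 5 + (r + 3) = K + 3 by omega, ← hden, ← hnum, Nat.cast_sum]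
  have hU : (38 * K.choose (r + 3 - 3) + 19 * K.choose (r + 3 - 2) + 6 * K.choose (r + 3 - 1) + K.choose (r + 3) : ℕ)
      = 38 * c3 + 19 * c2 + 6 * c1 + c0 := by
    simp only [show r + 3 - 3 = r by omega, show r + 3 - 2 = r + 1 by omega, show r + 3 - 1 = r + 2 by omega]
    rfl
  have hY : (∑ a ∈ Ico (r + 3 + 1) (r + s + 5), K.choose a + 6 * ∑ a ∈ Ico (r + 3) (r + s + 5 - 1), K.choose a
        + 19 * ∑ a ∈ Ico (r + 3 - 1) (r + s + 5 - 2), K.choose a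
        + 38 * ∑ a ∈ Ico (r + 3 - 2) (r + s + 5 - 3), K.choose a : ℕ) = A + 6 * B + 19 * Cc + 38 * D := by
    simp only [show r + 3 + 1 = r + 4 by omega, show r + s + 5 - 1 = r + s + 4 by omega,
      show r + 3 - 1 = r + 2 by omega, show r + s + 5 - 2 = r + s + 3 by omega, show r + 3 - 2 = r + 1 by omega,
      show r + s + 5 - 3 = r + s + 2 by omega]
    rfl
  have hAD : A = D := by
    rw [hA, hD, sum_choose_reflect K (r + 4) (r + s + 5) (by omega)]
    rw [show K + 1 - (r + s + 5) = r + 1 by omega, show K + 1 - (r + 4) = r + s + 2 by omega]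
  have hBC : B = Cc := by
    rw [hB, hCc, sum_choose_reflect K (r + 3) (r + s + 4) (by omega)]
    rw [show K + 1 - (r + s + 4) = r + 2 by omega, show K + 1 - (r + 3) = r + s + 3 by omega]
  have hsym : K.choose (r + s + 4) = c2 := by
    rw [hc2, ← Nat.choose_symm (show r + 1 ≤ K by omega), show K - (r + 1) = r + s + 4 by omega]
  have hBA : B + c2 = A + c0 := by
    rw [hB, hA, Finset.sum_eq_sum_Ico_succ_bot (show r + 3 < r + s + 4 by omega),
      Finset.sum_Ico_succ_top (show r + 4 ≤ r + s + 4 by omega), hsym, hc0]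
    ring
  have h32 : c3 ≤ c2 := Nat.choose_le_succ_of_lt_half_left (by omega)
  have h21 : c2 ≤ c1 := Nat.choose_le_succ_of_lt_half_left (by omega)
  have h10 : c1 ≤ c0 := by
    rcases Nat.eq_zero_or_pos s with hs | hs
    · subst hs
      have : K.choose (r + 3) = K.choose (r + 2) := by
        rw [hK, ← Nat.choose_symm (show r + 2 ≤ 2 * r + 0 + 5 by omega), show 2 * r + 0 + 5 - (r + 2) = r + 3 by omega]
      rw [hc1, hc0, this]
    · exact Nat.choose_le_succ_of_lt_half_left (by omega)
  have hA2 : c2 ≤ A := by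
    rw [hA, Finset.sum_Ico_succ_top (show r + 4 ≤ r + s + 4 by omega), hsym]
    exact Nat.le_add_left _ _
  have hc3pos : 0 < c3 := Nat.choose_pos (by omega)
  -- the ratio identities
  have r2 : c2 * (r + 1) = c3 * (r + s + 5) := by
    have := choose_ratio K r; rwa [show K - r = r + s + 5 by omega] at this
  have r1 : c1 * (r + 2) = c2 * (r + s + 4) := by
    have := choose_ratio K (r + 1); rwa [show K - (r + 1) = r + s + 4 by omega] at this
  have r0 : c0 * (r + 3) = c1 * (r + s + 3) := by
    have := choose_ratio K (r + 2); rwa [show K - (r + 2) = r + s + 3 by omega] at this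
  -- to ℚ
  rw [hphi, hU, hY]
  have hpos : (0 : ℚ) < ((c3 + 3 * c2 + 3 * c1 + c0 : ℕ) : ℚ) := by exact_mod_cast (by omega : 0 < c3 + 3 * c2 + 3 * c1 + c0)
  rw [div_mul_eq_mul_div, div_le_iff₀ hpos]
  have qAD : (A : ℚ) = D := by exact_mod_cast hAD
  have qBC : (B : ℚ) = Cc := by exact_mod_cast hBC
  have qBA : (B : ℚ) + c2 = A + c0 := by exact_mod_cast hBA
  have q32 : (c3 : ℚ) ≤ c2 := by exact_mod_cast h32
  have q21 : (c2 : ℚ) ≤ c1 := by exact_mod_cast h21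
  have q10 : (c1 : ℚ) ≤ c0 := by exact_mod_cast h10
  have qA2 : (c2 : ℚ) ≤ A := by exact_mod_cast hA2
  have qr2 : (c2 : ℚ) = c3 * (r + s + 5) / (r + 1) := by
    rw [eq_div_iff (by positivity)]; exact_mod_cast r2
  have qr1 : (c1 : ℚ) = c2 * (r + s + 4) / (r + 2) := by
    rw [eq_div_iff (by positivity)]; exact_mod_cast r1
  have qr0 : (c0 : ℚ) = c1 * (r + s + 3) / (r + 3) := by
    rw [eq_div_iff (by positivity)]; exact_mod_cast r0
  have qc3 : (0 : ℚ) < c3 := by exact_mod_cast hc3pos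
  -- the difference: A·coef + (c0 − c2)·(…) ≥ c2·coef + (c0 − c2)·(…) =: H ≥ 0
  have hcoef : (0 : ℚ) ≤ -240 * c3 + 40 * c2 + 144 * c1 + 56 * c0 := by linarith
  have hH : (0 : ℚ) ≤ c2 * (-240 * c3 + 40 * c2 + 144 * c1 + 56 * c0)
      + (c0 - c2) * (19 * c0 + 39 * c1 - 39 * c2 - 203 * c3) := by
    have key : (c2 : ℚ) * (-240 * c3 + 40 * c2 + 144 * c1 + 56 * c0)
        + (c0 - c2) * (19 * c0 + 39 * c1 - 39 * c2 - 203 * c3)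
        = c3 ^ 2 * ((385560 + 600552 * (r : ℚ) + 369768 * (r : ℚ)^2 + 112376 * (r : ℚ)^3 + 16832 * (r : ℚ)^4 + 992 * (r : ℚ)^5 + 369492 * (s : ℚ) + 471644 * (s : ℚ) * (r : ℚ) + 228252 * (s : ℚ) * (r : ℚ)^2 + 50900 * (s : ℚ) * (r : ℚ)^3 + 4896 * (s : ℚ) * (r : ℚ)^4 + 128 * (s : ℚ) * (r : ℚ)^5 + 167326 * (s : ℚ)^2 + 169906 * (s : ℚ)^2 * (r : ℚ) + 61536 * (s : ℚ)^2 * (r : ℚ)^2 + 9172 * (s : ℚ)^2 * (r : ℚ)^3 + 448 * (s : ℚ)^2 * (r : ℚ)^4 + 44655 * (s : ℚ)^3 + 34495 * (s : ℚ)^3 * (r : ℚ) + 8554 * (s : ℚ)^3 * (r : ℚ)^2 + 664 * (s : ℚ)^3 * (r : ℚ)^3 + 6967 * (s : ℚ)^4 + 3674 * (s : ℚ)^4 * (r : ℚ) + 478 * (s : ℚ)^4 * (r : ℚ)^2 + 573 * (s : ℚ)^5 + 153 * (s : ℚ)^5 * (r : ℚ) + 19 * (s : ℚ)^6)) / (((r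 : ℚ) + 1) * ((r : ℚ) + 2) * ((r : ℚ) + 3)) ^ 2 := by
      rw [qr0, qr1, qr2]
      field_simp
      ring
    rw [key]
    positivity
  push_cast
  nlinarith [hH, mul_nonneg (sub_nonneg.2 qA2) hcoef]

end PercRepro.LineLadder
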